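import Mathlib.Data.Nat.Choose.Bounds
import Summits.ValiantsHypothesis.ValiantsHypothesis.Theorems.LacunarySymmetroidMatrixDescartesCensusFrame
import Summits.ValiantsHypothesis.ValiantsHypothesis.Theorems.LacunarySymmetroidMatrixDescartesCensusTropicalKLawBridges

/-!
# Route «KPlusLogSqLaw», lifting stubs — CALIBRATION: every finite-size range of the thin stubs is Descartes-vacuous

HONEST FRAMING.  A calibration note in kernel form for the registered lifting stubs of route `KPlusLogSqLaw` (object-search cell
`pub-symmetroid`): `stub_liftThin` of the aside `Summit.ValiantsHypothesis.ValiantsHypothesis.Theses.KPlusLogSqLaw.Lifting`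
(ledger item `stmt-ValiantsHypothesis-19772`, skeleton `Cruxes/Lifting/Lines/birth.lean`) and `stub_weakLiftThin` of the live crux
`…KPlusLogSqLaw.WeakLifting` (`stmt-ValiantsHypothesis-19561`, skeleton `Cruxes/WeakLifting/Lines/birth.lean`); seat
val-sym-lift-p1 (g3), 2026-08-26.  It proves ONE elementary inequality and reads the stubs through it; nothing here bears on the
stubs in their window, on `TropicalB`, `KPlusLogSqLaw`, the cell's census / registers, `MatrixDescartes` (`stmt-ValiantsHypothesis-18050`)
or `VP ≠ VNP`.

THE POINT.  By Descartes (`Census.realRootLawAt_descartes`: `Z ≤ 2·C(m+K−1, m) − 1`) and `C(m+K−1, m) = C(m+K−1, K−1) ≤ (m+K−1)^(K−1)`,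
every format with `m + K − 1 ≤ 2^C` satisfies the real row `RealRootLawAt m K (2^(C·K))` OUTRIGHT — no tropical input, no regime
hypothesis (`realRootLawAt_two_pow_of_le`).  Consequently the thin stubs hold VERBATIM on every finite range of sizes with a constant
depending only on the range (`liftThin_of_le_two_pow`, `weakLiftThin_of_le_two_pow`: all `m ≤ 2^C − K + 1`, e.g. `C = 13` covers
`m + K ≤ 8193`), so a partial-range theorem «the stub for all `m ≤ M`» carries no information about the stub: its content is
ASYMPTOTIC IN `m` AT EACH FIXED `K` (at rung `K` the Descartes route needs tropical families with
`T(m,K) + 1 ≥ 2·C(m+K−1, K−1)/2^(C·K)` for all large `m`, i.e. counting-tight up to `2^{O(K)}` — proved for `K ≤ 3`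
(`KPlusLogSqLaw.stub_liftRungThree`), the cell's D2 fork at `K = 4`).  This supersedes nothing and corrects nothing in the tree; it
only fixes the reading of finite-range forms such as `KPlusLogSqLaw.stub_liftThin_of_le_seven` (whose `C = 3` is smaller than the
vacuous constant for `m ≤ 7`, `C = 4`, so that theorem keeps a (thin) content of its own).
-/

set_option linter.dupNamespace false
set_option autoImplicit false

namespace Summit.ValiantsHypothesis.ValiantsHypothesis.Theorems.KPlusLogSqLaw

open Summit.ValiantsHypothesis.ValiantsHypothesis.Theorems.LacunarySymmetroidMatrixDescartes (RealRootLawAt)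
open Summit.ValiantsHypothesis.ValiantsHypothesis.Theorems.LacunarySymmetroidMatrixDescartes.TropicalCensus

/-- the Descartes count of a format below a power of two: `m + K − 1 ≤ 2^C ⇒ 2·C(m+K−1, m) − 1 ≤ 2^(C·K)` (for `K ≥ 1`). [folklore] -/
theorem two_mul_choose_sub_one_le_two_pow {m K C : ℕ} (hK : 0 < K) (h : m + K - 1 ≤ 2 ^ C) :
    2 * Nat.choose (m + K - 1) m - 1 ≤ 2 ^ (C * K) := by
  have h1 : Nat.choose (m + K - 1) m = Nat.choose (m + K - 1) (K - 1) := by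
    have : m + K - 1 = m + (K - 1) := by omega
    rw [this, Nat.choose_symm_add]
  have h2 : Nat.choose (m + K - 1) (K - 1) ≤ (2 ^ C) ^ (K - 1) :=
    (Nat.choose_le_pow _ _).trans (Nat.pow_le_pow_left h _)
  rw [← pow_mul] at h2
  rcases Nat.eq_zero_or_pos C with hC | hC
  · subst hC
    simp only [zero_mul, pow_zero] at h2 ⊢
    omega
  · have h3 : 2 * 2 ^ (C * (K - 1)) ≤ 2 ^ (C * K) := by
      rw [← pow_succ']
      exact Nat.pow_le_pow_right (by norm_num) (by
        have : C * K = C * (K - 1) + C := by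
          rcases K with _ | K
          · omega
          · simp [Nat.mul_succ]
        omega)
    omega

/-- **Every format with `m + K − 1 ≤ 2^C` satisfies `RealRootLawAt m K (2^(C·K))` by Descartes alone** (no tropical input, no
regime hypothesis). [folklore] -/
theorem realRootLawAt_two_pow_of_le (m K C : ℕ) (h : m + K - 1 ≤ 2 ^ C) : RealRootLawAt m K (2 ^ (C * K)) := by
  rcases Nat.eq_zero_or_pos K with hK | hK
  · subst hK; exact realRootLawAt_zero m _
  · exact LacunarySymmetroidMatrixDescartes.Census.realRootLawAt_mono (two_mul_choose_sub_one_le_two_pow hK h)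
      (LacunarySymmetroidMatrixDescartes.Census.realRootLawAt_descartes m K hK)

/-- **The thin stub `stub_liftThin` is Descartes-vacuous on every finite range of sizes**: for all `m + K − 1 ≤ 2^C` (in particular
all `m ≤ 2^C − K + 1`), `TropRootLawAt m K n → RealRootLawAt m K (2^(C·K)·(n+1))` with the tropical hypothesis AND the regime
hypothesis `K ≤ log₂² m` unused.  (Stub shape verbatim: `TropRootLawAt` is δ-equal to the skeleton's `TropRow`.) [folklore] -/
theorem liftThin_of_le_two_pow (C m K n : ℕ) (h : m + K - 1 ≤ 2 ^ C) (_hK : K ≤ Nat.log 2 m ^ 2)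
    (_hT : TropRootLawAt m K n) : RealRootLawAt m K (2 ^ (C * K) * (n + 1)) :=
  LacunarySymmetroidMatrixDescartes.Census.realRootLawAt_mono (Nat.le_mul_of_pos_right _ (Nat.succ_pos n))
    (realRootLawAt_two_pow_of_le m K C h)

/-- **The weak thin stub `stub_weakLiftThin` is Descartes-vacuous on every finite range of sizes** (same statement with the weak
budget `2^(C·(K + log₂² m))·(n+1) ≥ 2^(C·K)·(n+1)`). [folklore] -/
theorem weakLiftThin_of_le_two_pow (C m K n : ℕ) (h : m + K - 1 ≤ 2 ^ C) (_hK : K ≤ Nat.log 2 m ^ 2)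
    (_hT : TropRootLawAt m K n) : RealRootLawAt m K (2 ^ (C * (K + Nat.log 2 m ^ 2)) * (n + 1)) := by
  refine LacunarySymmetroidMatrixDescartes.Census.realRootLawAt_mono ?_ (realRootLawAt_two_pow_of_le m K C h)
  calc 2 ^ (C * K) ≤ 2 ^ (C * (K + Nat.log 2 m ^ 2)) :=
        Nat.pow_le_pow_right (by norm_num) (Nat.mul_le_mul_left _ (Nat.le_add_right _ _))
    _ ≤ 2 ^ (C * (K + Nat.log 2 m ^ 2)) * (n + 1) := Nat.le_mul_of_pos_right _ (Nat.succ_pos n)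

/-- **The registered stub VERBATIM for all sizes `m ≤ 8049`, constant `C = 13`** (there `Nat.log 2 m ≤ 12`, so the regime gives
`K ≤ 144` and `m + K − 1 ≤ 2^13`).  Honest reading: NO content — a Descartes-vacuous range, see the module docstring; compare
`KPlusLogSqLaw.stub_liftThin_of_le_seven` (`m ≤ 7`, `C = 3`). [folklore] -/
theorem stub_liftThin_of_le_8049 :
    ∃ C : ℕ, ∀ m K n : ℕ, m ≤ 8049 → K ≤ Nat.log 2 m ^ 2 → TropRootLawAt m K n →
      RealRootLawAt m K (2 ^ (C * K) * (n + 1)) := by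
  refine ⟨13, fun m K n hm hK hT => liftThin_of_le_two_pow 13 m K n ?_ hK hT⟩
  have hlog : Nat.log 2 m ≤ 12 := by
    rcases Nat.eq_zero_or_pos m with h0 | h0
    · subst h0; simp
    · have := Nat.log_lt_of_lt_pow (Nat.pos_iff_ne_zero.mp h0) (show m < 2 ^ 13 by omega)
      omega
  have hK' : K ≤ 144 := hK.trans (by nlinarith [hlog, Nat.zero_le (Nat.log 2 m)])
  omega

/-- **The weak registered stub VERBATIM for all sizes `m ≤ 8049`, constant `C = 13`.**  Honest reading: NO content (Descartes-vacuous
range). [folklore] -/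
theorem stub_weakLiftThin_of_le_8049 :
    ∃ C : ℕ, ∀ m K n : ℕ, m ≤ 8049 → K ≤ Nat.log 2 m ^ 2 → TropRootLawAt m K n →
      RealRootLawAt m K (2 ^ (C * (K + Nat.log 2 m ^ 2)) * (n + 1)) := by
  refine ⟨13, fun m K n hm hK hT => weakLiftThin_of_le_two_pow 13 m K n ?_ hK hT⟩
  have hlog : Nat.log 2 m ≤ 12 := by
    rcases Nat.eq_zero_or_pos m with h0 | h0
    · subst h0; simp
    · have := Nat.log_lt_of_lt_pow (Nat.pos_iff_ne_zero.mp h0) (show m < 2 ^ 13 by omega)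
      omega
  have hK' : K ≤ 144 := hK.trans (by nlinarith [hlog, Nat.zero_le (Nat.log 2 m)])
  omega

end Summit.ValiantsHypothesis.ValiantsHypothesis.Theorems.KPlusLogSqLaw
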